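import Summits.QuantumFields.BalabanUV.T4Continuum.Support.NE7ConvOneStepWeightedCriticalUnique
import Summits.QuantumFields.BalabanUV.T4Continuum.Support.NE7CriticalPairLettersOfRoutePi
import Summits.QuantumFields.BalabanUV.T4Continuum.Support.NE7TanCriticalGauge
import HarnessLib

/-!
# NE7CriticalPairOfRoutePi — THE CURVED (APE) AT A TANGENT-CRITICAL REFERENCE IS UNIQUENESS, SUPPLIED BY ROW NE3's ROUTE Π: two TANGENT-CRITICAL
# admissible configurations on ONE fibre of the class, the second represented over the first by the per-pair binder `hleaves` of the ONE-STEP END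
# (F30 ∕ F31) plus ONE far-end local quadratic letter, are GAUGE EQUIVALENT — hence the second is as small as the first; NO Green's-function row

Cell `pub-balaban`, rung (B)+1 sub-cell t4, lineage `b2b-balaban-t4-ne7-p1` (CRUX PROVER NE7 #1 = OWNER of row NE7), generation 87; memo
`t4/b2b-balaban-t4-ne7-p1-g87/ROAD-B-IS-UNIQUENESS.md` §2.  File F235 (over F233 `NE7ConvOneStepWeightedCriticalUnique`, F234 `NE7CriticalPairLettersOfRoutePi`,
F39 `NE7TanCriticalGauge`).

WHY.  Road (B)'s END of record F232 (`NE7ApeCurvedRepRoadBClassRowsEnd`, g86) — «a tangent-critical `U` of the class on the fibre of a TANGENT-CRITICAL `W` (`hcritW`,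
`hTopUW`), gauge-close to `W`, has `SmallField U (x + …)`» — displays three sup-norm rows of Green's functions ([B9] Thm 3.3 (3.42)₁,₂ ∕ (3.49) SHAPE, the wall (ε)).
Its mathematical content is the CRITICAL-POINT HALF of [Balaban1985Variational] Prop. 7 (at most one critical orbit): F7 (g66, `dirSq` currency — letters not met
k-uniformly, memo H11 §1) and F233 (this gen, weighted currency, letters met by row NE3's smooth right inverse).  THIS FILE is the END: F233's letters are supplied
by F234 from the SAME per-pair binder `hleaves` that F31's ONE-STEP END already displays (row NE3's route Π), plus ONE far-end local quadratic letter of the same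
(Π-REG-γ) TYPE; the far ℓ¹-curl constant is `κ̂∕4 ≤ κ̂∕(1−ν̂)²`, so F31's TWO k-free numeric lines serve VERBATIM.  No Green's function, no sup-norm row, no bootstrap.
WHAT ([folklore]; 0 def, 0 sorry).
§1 (the letters are F234's `baseLetters_of_routePi`, `farLetter_of_routePi`.)
§2 **`gaugeAct_eq_of_tanCritical_pair_routePi`** — THE END: uniform hypotheses = F31's (`LevelSmall d L k (ε∕M²)`, W6 regime `thetaLoc·ε < 1`, `ε ≤ 1`, ceilings
   `0 ≤ α̂ ≤ 1`, `Ĉ ≥ 0`, `C₂ ≥ 0`, (P♮)_W on the class with `CP > 0`, `ν̂ < 1`, ONE strict k-free line); per pair: `U♯, U′ ∈ admissible (sfClass d L N ε) L (k+1) V`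
   BOTH TANGENT-CRITICAL, the `hleaves` data `(u, X₀, α₀, m, C)` of the pair, and the far quadratic letter at `U′^u` ⟹ `U′^u = U♯`;
   **`smallField_of_tanCritical_pair_routePi`** ⟹ `SmallField U♯ r → SmallField U′ r` for EVERY `r` (road (B)'s conclusion `SmallField U x`, exactly, no correction).
HONEST FRAMING (page 1): bookkeeping over row NE3's landed kernel theorems and F233 ∕ F234; the per-pair representation with its weight and TWO local quadratic letters
(base and far) and the numeric lines are HYPOTHESES (row NE3's binder, B11 Prop. 2 ∕ (Π-REG-γ) TYPE), asserted for nothing; this is NOT the a-priori estimate WITH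
GAIN (`hape` of F31: radius `δ∕M² ⟹ δ₁∕M²` with NO reference), which road (B) never supplied and which remains the wall; NOT ONE-STEP, NOT NE7; spine 0∕9;
finite T⁴ rung (B)+1 — NOT infinite volume, NOT mass gap, NOT `BetaPertH`, NOT Clay.  Continuum YM on T⁴ ⇐ BetaPertH ∧ nine spine estimates (0/9 proved);
BetaPertH ⇐ (D1) ∧ (D4) ∧ CAP+tail; G-an2-4 gates asym, D1 and NE2/3/4.
-/

set_option autoImplicit false

open scoped BigOperators Matrix Matrix.Norms.L2Operator
open NormedSpace Finset Set

namespace Summit.QuantumFields.BalabanUV.T4Continuum.NE7CriticalPairOfRoutePi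

open Literature.MathematicalPhysics.QuantumFieldTheory.Balaban1983to89
open B7Prop1Explicit B7Prop2Explicit
open T4AveragingDeficitWall (IsUnitaryCfg IsSkewDir SmallField vary curl curlSq dirSq dirL1)
open T4AveragingDeficitWallBoundary (IsPeriodicCfg periodBox)
open AveragingDeficitPeriodicCounting (IsPeriodicDir)
open AveragingDeficitMultiLevelPrep (LevelSmall tower TangentIter)
open MinimalActionLevels (perWin)
open MinimalActionSandwich (admissible)
open MinimalActionRate (sfClass)
open NE3HessForm (dAction)
open NE3EnergyShapes (IsUnitarySite IsPeriodicSite)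
open NE3EnergyWeightedShapes (energyNormW energyNormW_nonneg)
open NE3WeightedCoercivityTransfer (energyNormW_sq)
open NE3EnergyHessContTwoTerm (curlSq_nonneg dirSq_nonneg)
open NE3ProductPathBounds (energyNormW_sub_le)
open NE3TangentCovariantTower (dirIter tangentIter_iff_dirIter_eq_zero)
open NE3FrameFreeSliceW (frameFreeBlockLandauW)
open NE3SlicePoincareShape (SlicePoincare)
open NE3ResidualSliceRep (dirIter_sub isPeriodicCfg_gaugeAct)
open NE3DecomposedRepOfLinearNormalPart (ResidualSliceRepT)
open NE3LinearNormalPartPreSizes (preSizes_of_letters dirL1_coarse_le)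
open NE3EnergyRateWSupRoutePiRInv (dirIter_skew isPeriodicDir_dirIter)
open NE3DecomposedRepSfClass (levelRadius_rescale)
open NE3QbarIterCovLiftPrep (cruxC)
open NE3SmoothRightInverseW (rightInvW)
open NE3RightInverseSolveLetters (thetaLoc cruxC_nonneg cruxC_le_thetaLoc)
open NE3RightInverseL2Letter (l2C l2C_nonneg)
open NE3RightInverseL1Letter (l1C l1C_nonneg)
open NE3HatInvCurlLetters (curl2C curl1C curl2C_nonneg curl1C_nonneg)
open NE3RightInverseLetters (rightInvW_exact rightInvW_skew rightInvW_periodic rightInvW_R1 curlSq_rightInvW_le sum_norm_curl_rightInvW_le rightInvW_R4)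
open NE7RepWGaugeOfRoutePi (sub_mem_frameFreeBlockLandauW_symm line_of_kfree_line)
open NE7ConvOneStepWeightedCriticalUnique (vary_eq_self_of_tanCritical_pair_repW)
open NE7ConvOneStepWeightedUnique (smallField_of_gaugeAct_eq)
open NE7TanCriticalGauge (tanCritical_gaugeAct)
open BlockAverageCurrent (smallField_gaugeAct)

open NE7CriticalPairLettersOfRoutePi (farLetter_of_routePi baseLetters_of_routePi)

noncomputable section

variable {d : ℕ} {n : Type*} [Fintype n] [DecidableEq n]

/-! ## §2 THE END: two tangent-critical admissible configurations on one fibre, represented by route Π, are gauge equivalent -/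

set_option maxHeartbeats 400000 in
-- statement-level budget (the `hrep` binder), as in F30 ∕ F31
/-- **THE CURVED (APE) AT A TANGENT-CRITICAL REFERENCE, FROM ROW NE3's ROUTE Π — NO GREEN's-FUNCTION ROW.**  UNIFORM (= F31's): `L ≥ 2`, `0 < ε ≤ 1`,
`LevelSmall d L k (ε∕M²)`, W6 regime `thetaLoc d L·ε < 1`, ceilings `0 ≤ α̂ ≤ 1`, `Ĉ ≥ 0`, the quadratic constant `C₂ ≥ 0`, (P♮)_W on the class with `CP > 0`,
`ν̂ := 2√(l2C∕(1−θℓ)² + curl2C∕(1−θℓ)²)·C₂·Ĉ·α̂ < 1`, `κ̂ := 4(curl1C∕(1−θℓ))·C₂·Ĉ²·ε`, ONE strict k-free line (F30 ∕ F31's, verbatim).  PER PAIR: `U♯, U′ ∈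
admissible (sfClass d L N ε) L (k+1) V` BOTH TANGENT-CRITICAL; the `hleaves` data of the pair — the residual slice representative `U′^u = U♯e^{X₀}` adapted to
`rightInvW`, the weight `m ≥ 0` with `M^dΣm² ≤ C²dirSq X₀`, the BASE local quadratic letter, the currencies `α₀M ≤ α̂`, `mM ≤ α̂`, `C ≤ Ĉ` — and THE FAR LOCAL
QUADRATIC LETTER `‖dirIter L (k+1) (U′^u) X₀ (z,κ)‖ ≤ C₂(M·m(z,κ))²`.  THEN `U′^u = U♯`. [folklore] -/
theorem gaugeAct_eq_of_tanCritical_pair_routePi [Nonempty n] {L N : ℕ} [NeZero L] [NeZero N] (hL : 2 ≤ L) (k : ℕ) {ε : ℝ} (hε : 0 < ε)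
    (hls : LevelSmall d L k (ε / ((L : ℝ) ^ (k + 1)) ^ 2)) (hθl : thetaLoc d L * ε < 1) (hε1 : ε ≤ 1)
    {C₂ αh Ch CP : ℝ} (hC₂ : 0 ≤ C₂) (hαh0 : 0 ≤ αh) (hαh1 : αh ≤ 1) (hCh0 : 0 ≤ Ch) (hCP : 0 < CP)
    (hP : ∀ (j : ℕ) (W : Site d → Fin d → (Matrix n n ℂ)ˣ), W ∈ sfClass d L N ε (j + 1) →
      SlicePoincare L (j + 1) W (frameFreeBlockLandauW L N (j + 1) W) CP (periodBox (d := d) (N * L ^ (j + 1))))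
    {νh κh : ℝ} (hνh : νh = 2 * Real.sqrt (l2C d L / (1 - thetaLoc d L * ε) ^ 2 + curl2C d L / (1 - thetaLoc d L * ε) ^ 2) * C₂ * Ch * αh)
    (hκh : κh = 4 * (curl1C d L / (1 - thetaLoc d L * ε)) * C₂ * Ch ^ 2 * ε) (hν : νh < 1)
    (hline : 2 * (κh / (1 - νh) ^ 2) < ((((1 / 2 - (νh / (1 - νh)) ^ 2) / (2 * (1 + CP)) - (νh / (1 - νh)) ^ 2) / 2
        - 576 * d * (αh ^ 2 * Real.exp (2 * αh))) / (Fintype.card n : ℝ) - 28 * d * (ε + 7 * αh ^ 2)))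
    {V Us U' : Site d → Fin d → (Matrix n n ℂ)ˣ} (hmem : Us ∈ admissible (sfClass d L N ε) L (k + 1) V)
    (hU' : U' ∈ admissible (sfClass d L N ε) L (k + 1) V)
    (hcritT : ∀ φ : Site d → Fin d → Matrix n n ℂ, IsSkewDir φ → IsPeriodicDir φ ((N * L ^ (k + 1) : ℕ) : ℤ) → TangentIter L k Us φ →
      dAction Us φ (perWin d (N * L ^ (k + 1))) = 0)
    (hcritU' : ∀ φ : Site d → Fin d → Matrix n n ℂ, IsSkewDir φ → IsPeriodicDir φ ((N * L ^ (k + 1) : ℕ) : ℤ) → TangentIter L k U' φ →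
      dAction U' φ (perWin d (N * L ^ (k + 1))) = 0)
    {u : Site d → (Matrix n n ℂ)ˣ} {X₀ : Site d → Fin d → Matrix n n ℂ} {α₀ : ℝ} {m : Site d → Fin d → ℝ} {C : ℝ}
    (hXs : IsSkewDir X₀)
    (hrep : ∀ (hWu : IsUnitaryCfg Us) (hx : 0 ≤ ε / ((L : ℝ) ^ (k + 1)) ^ 2) (hs : LevelSmall d L k (ε / ((L : ℝ) ^ (k + 1)) ^ 2))
        (hWx : SmallField Us (ε / ((L : ℝ) ^ (k + 1)) ^ 2))
        (hθ : cruxC d L * (((L : ℝ) ^ (k + 1)) ^ 2 * (ε / ((L : ℝ) ^ (k + 1)) ^ 2)) < 1)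
        (hφ : IsSkewDir (dirIter L (k + 1) Us X₀)),
      ResidualSliceRepT L N (k + 1) Us U' u X₀ (rightInvW hL k hWu hx hs hWx N hθ hφ) α₀)
    (hm0 : ∀ z κ, 0 ≤ m z κ) (hC : 0 ≤ C)
    (hsq : ((L : ℝ) ^ (k + 1)) ^ d * ∑ z ∈ periodBox (d := d) N, ∑ κ : Fin d, m z κ ^ 2
      ≤ C ^ 2 * dirSq X₀ (periodBox (d := d) (N * L ^ (k + 1))))
    (hφq : ∀ z ∈ periodBox (d := d) N, ∀ κ : Fin d, ‖dirIter L (k + 1) Us X₀ z κ‖ ≤ C₂ * ((L : ℝ) ^ (k + 1) * m z κ) ^ 2)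
    (hαh : α₀ * (L : ℝ) ^ (k + 1) ≤ αh) (hmh : ∀ z κ, m z κ * (L : ℝ) ^ (k + 1) ≤ αh) (hCh : C ≤ Ch)
    (hφq' : ∀ z ∈ periodBox (d := d) N, ∀ κ : Fin d, ‖dirIter L (k + 1) (gaugeAct u U') X₀ z κ‖ ≤ C₂ * ((L : ℝ) ^ (k + 1) * m z κ) ^ 2) :
    gaugeAct u U' = Us := by
  have hL1 : 1 ≤ L := by omega
  have hNpos : 1 ≤ N := Nat.one_le_iff_ne_zero.mpr (NeZero.ne N)
  have hx : 0 ≤ ε / ((L : ℝ) ^ (k + 1)) ^ 2 := by positivity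
  -- the base letters with explicit witnesses
  obtain ⟨XT, XN, hu, huP, hXP, hα₀, hsup, hgauge, hsplit, hXT, hXNs, hNw, hN1⟩ :=
    baseLetters_of_routePi hL k hε hls hθl hε1 hC₂ hαh0 hαh1 hCh0 hνh hκh hν hmem.1 hXs hrep hm0 hC hsq hφq hmh hCh
  -- the far configuration `U♭ := U′^u = U♯e^{X₀}` is of the class and tangent-critical
  have hUbP : IsPeriodicCfg (gaugeAct u U') ((N * L ^ (k + 1) : ℕ) : ℤ) := isPeriodicCfg_gaugeAct huP hU'.1.2.1
  have hUbx : SmallField (gaugeAct u U') (ε / ((L : ℝ) ^ (k + 1)) ^ 2) := smallField_gaugeAct hu hU'.1.2.2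
  have hUbu : IsUnitaryCfg (gaugeAct u U') := by
    rw [hgauge]; exact AveragingDeficitPlaqDeriv.vary_isUnitaryCfg hmem.1.1 hXs 1
  have hUb : (vary Us X₀ 1) ∈ sfClass d L N ε (k + 1) := by
    rw [← hgauge]; exact ⟨hUbu, hUbP, hUbx⟩
  have hcritb := tanCritical_gaugeAct hL1 k hU'.1.1 hx hls hU'.1.2.2 hu huP
    (fun φ hφs hφP hφT => hcritU' φ hφs hφP ((tangentIter_iff_dirIter_eq_zero L k U' φ).2 hφT))
  have hcritT' : ∀ φ : Site d → Fin d → Matrix n n ℂ, IsSkewDir φ → IsPeriodicDir φ ((N * L ^ (k + 1) : ℕ) : ℤ) →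
      TangentIter L k (vary Us X₀ 1) φ → dAction (vary Us X₀ 1) φ (perWin d (N * L ^ (k + 1))) = 0 := by
    intro φ hφs hφP hφT
    rw [← hgauge] at hφT ⊢
    exact hcritb φ hφs hφP ((tangentIter_iff_dirIter_eq_zero L k _ φ).1 hφT)
  -- the far letter at `U♭` with the SAME weight, in the energy currency at `U♯`
  have hφqb : ∀ z ∈ periodBox (d := d) N, ∀ κ : Fin d, ‖dirIter L (k + 1) (vary Us X₀ 1) X₀ z κ‖ ≤ C₂ * ((L : ℝ) ^ (k + 1) * m z κ) ^ 2 := by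
    rw [← hgauge]; exact hφq'
  obtain ⟨XT', XN', hsplit', hXT's, hXT'P, hXT'T, hXN's, hN1'⟩ :=
    farLetter_of_routePi hL k hε hls hθl hε1 hC₂ hUb hXs hXP hC hsq hφqb hCh Us
  -- the per-level strict line for `κ₁ + κ′₁ ≤ 2κ₁`
  have hcard : 0 < (Fintype.card n : ℝ) := by exact_mod_cast Fintype.card_pos
  have hlineK := line_of_kfree_line (n := n) (d := d) hL1 k hα₀ hαh hcard (ν := νh / (1 - νh)) (κ₁ := κh / (1 - νh) ^ 2) (CP := CP) hline
  have h1θl : 0 < 1 - thetaLoc d L * ε := by linarith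
  have hk0 : 0 ≤ κh := by
    rw [hκh]; have := curl1C_nonneg d L; positivity
  have hν0 : 0 ≤ νh := by
    rw [hνh]; have := l2C_nonneg d L; have := curl2C_nonneg d L; positivity
  have hfar_le : (curl1C d L / (1 - thetaLoc d L * ε)) * C₂ * Ch ^ 2 * ε ≤ κh / (1 - νh) ^ 2 := by
    have e : (curl1C d L / (1 - thetaLoc d L * ε)) * C₂ * Ch ^ 2 * ε = κh / 4 := by rw [hκh]; ring
    rw [e]
    have h1ν : 0 < 1 - νh := by linarith
    have h1 : 0 < (1 - νh) ^ 2 := by positivity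
    have h2 : (1 - νh) ^ 2 ≤ 1 := by nlinarith
    rw [div_le_div_iff₀ (by norm_num : (0:ℝ) < 4) h1]
    nlinarith
  have hline' : κh / (1 - νh) ^ 2 + (curl1C d L / (1 - thetaLoc d L * ε)) * C₂ * Ch ^ 2 * ε
      < ((((1 / 2 - (νh / (1 - νh)) ^ 2) / (2 * (1 + CP)) - (νh / (1 - νh)) ^ 2) / 2
        - 576 * d * (Real.exp α₀ - 1) ^ 2 * ((L : ℝ) ^ (k + 1)) ^ 2) / (Fintype.card n : ℝ)
        - 28 * d * (ε / ((L : ℝ) ^ (k + 1)) ^ 2 + 7 * α₀ ^ 2) * ((L : ℝ) ^ (k + 1)) ^ 2) := by linarith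
  exact NE7ConvOneStepWeightedCriticalUnique.gaugeAct_eq_of_tanCritical_pair hL1 hNpos hε.le hCP hP hmem hcritT hu hXs hXP hα₀ hsup hgauge hU'
    hsplit hXT hXNs hNw hN1 hcritT' hsplit' hXT's hXT'P hXT'T hXN's hN1' hline'

set_option maxHeartbeats 400000 in
-- statement-level budget (the `hrep` binder), as in F30 ∕ F31
/-- **HENCE THE SECOND TANGENT-CRITICAL CONFIGURATION IS AS SMALL AS THE FIRST** (road (B)'s END shape «`SmallField U x`», exactly, with no correction term and
no Green's-function row): under the hypotheses of `gaugeAct_eq_of_tanCritical_pair_routePi`, `SmallField U♯ r → SmallField U′ r` for every `r`. [folklore] -/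
theorem smallField_of_tanCritical_pair_routePi [Nonempty n] {L N : ℕ} [NeZero L] [NeZero N] (hL : 2 ≤ L) (k : ℕ) {ε : ℝ} (hε : 0 < ε)
    (hls : LevelSmall d L k (ε / ((L : ℝ) ^ (k + 1)) ^ 2)) (hθl : thetaLoc d L * ε < 1) (hε1 : ε ≤ 1)
    {C₂ αh Ch CP : ℝ} (hC₂ : 0 ≤ C₂) (hαh0 : 0 ≤ αh) (hαh1 : αh ≤ 1) (hCh0 : 0 ≤ Ch) (hCP : 0 < CP)
    (hP : ∀ (j : ℕ) (W : Site d → Fin d → (Matrix n n ℂ)ˣ), W ∈ sfClass d L N ε (j + 1) →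
      SlicePoincare L (j + 1) W (frameFreeBlockLandauW L N (j + 1) W) CP (periodBox (d := d) (N * L ^ (j + 1))))
    {νh κh : ℝ} (hνh : νh = 2 * Real.sqrt (l2C d L / (1 - thetaLoc d L * ε) ^ 2 + curl2C d L / (1 - thetaLoc d L * ε) ^ 2) * C₂ * Ch * αh)
    (hκh : κh = 4 * (curl1C d L / (1 - thetaLoc d L * ε)) * C₂ * Ch ^ 2 * ε) (hν : νh < 1)
    (hline : 2 * (κh / (1 - νh) ^ 2) < ((((1 / 2 - (νh / (1 - νh)) ^ 2) / (2 * (1 + CP)) - (νh / (1 - νh)) ^ 2) / 2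
        - 576 * d * (αh ^ 2 * Real.exp (2 * αh))) / (Fintype.card n : ℝ) - 28 * d * (ε + 7 * αh ^ 2)))
    {V Us U' : Site d → Fin d → (Matrix n n ℂ)ˣ} (hmem : Us ∈ admissible (sfClass d L N ε) L (k + 1) V)
    (hU' : U' ∈ admissible (sfClass d L N ε) L (k + 1) V)
    (hcritT : ∀ φ : Site d → Fin d → Matrix n n ℂ, IsSkewDir φ → IsPeriodicDir φ ((N * L ^ (k + 1) : ℕ) : ℤ) → TangentIter L k Us φ →
      dAction Us φ (perWin d (N * L ^ (k + 1))) = 0)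
    (hcritU' : ∀ φ : Site d → Fin d → Matrix n n ℂ, IsSkewDir φ → IsPeriodicDir φ ((N * L ^ (k + 1) : ℕ) : ℤ) → TangentIter L k U' φ →
      dAction U' φ (perWin d (N * L ^ (k + 1))) = 0)
    {u : Site d → (Matrix n n ℂ)ˣ} {X₀ : Site d → Fin d → Matrix n n ℂ} {α₀ : ℝ} {m : Site d → Fin d → ℝ} {C : ℝ}
    (hXs : IsSkewDir X₀)
    (hrep : ∀ (hWu : IsUnitaryCfg Us) (hx : 0 ≤ ε / ((L : ℝ) ^ (k + 1)) ^ 2) (hs : LevelSmall d L k (ε / ((L : ℝ) ^ (k + 1)) ^ 2))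
        (hWx : SmallField Us (ε / ((L : ℝ) ^ (k + 1)) ^ 2))
        (hθ : cruxC d L * (((L : ℝ) ^ (k + 1)) ^ 2 * (ε / ((L : ℝ) ^ (k + 1)) ^ 2)) < 1)
        (hφ : IsSkewDir (dirIter L (k + 1) Us X₀)),
      ResidualSliceRepT L N (k + 1) Us U' u X₀ (rightInvW hL k hWu hx hs hWx N hθ hφ) α₀)
    (hm0 : ∀ z κ, 0 ≤ m z κ) (hC : 0 ≤ C)
    (hsq : ((L : ℝ) ^ (k + 1)) ^ d * ∑ z ∈ periodBox (d := d) N, ∑ κ : Fin d, m z κ ^ 2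
      ≤ C ^ 2 * dirSq X₀ (periodBox (d := d) (N * L ^ (k + 1))))
    (hφq : ∀ z ∈ periodBox (d := d) N, ∀ κ : Fin d, ‖dirIter L (k + 1) Us X₀ z κ‖ ≤ C₂ * ((L : ℝ) ^ (k + 1) * m z κ) ^ 2)
    (hαh : α₀ * (L : ℝ) ^ (k + 1) ≤ αh) (hmh : ∀ z κ, m z κ * (L : ℝ) ^ (k + 1) ≤ αh) (hCh : C ≤ Ch)
    (hφq' : ∀ z ∈ periodBox (d := d) N, ∀ κ : Fin d, ‖dirIter L (k + 1) (gaugeAct u U') X₀ z κ‖ ≤ C₂ * ((L : ℝ) ^ (k + 1) * m z κ) ^ 2)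
    {r : ℝ} (hUsr : SmallField Us r) : SmallField U' r := by
  have hg := gaugeAct_eq_of_tanCritical_pair_routePi hL k hε hls hθl hε1 hC₂ hαh0 hαh1 hCh0 hCP hP hνh hκh hν hline hmem hU' hcritT hcritU' hXs hrep
    hm0 hC hsq hφq hαh hmh hCh hφq'
  obtain ⟨-, -, hu, -⟩ := baseLetters_of_routePi hL k hε hls hθl hε1 hC₂ hαh0 hαh1 hCh0 hνh hκh hν hmem.1 hXs hrep hm0 hC hsq hφq hmh hCh
  exact smallField_of_gaugeAct_eq hu hg hUsr

end

end Summit.QuantumFields.BalabanUV.T4Continuum.NE7CriticalPairOfRoutePi
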